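import Summits.RiemannHypothesis.RiemannHypothesis.Theorems.WeilFormatCCinfCouplingFamilies
import Summits.RiemannHypothesis.RiemannHypothesis.Theorems.WeilFormatCCinfImageGlue
import HarnessLib

/-!
# Format C, design C∞ (E3, analytic side): the EVEN `hUq` of the DoorB certificates from collected monomial data

Route context: Fourier–Galerkin / Schur-complement certificates of Weil positivity on a window ("format C", C∞ door;
cell memo `run/shared/lean/pub/rh-explicit/rh-explicit-weil-10/KERNEL-LEVER.md` §21; supporting stmt-RiemannHypothesis-0098;
seat rh-explicit-weil-10).  This is the even-sector kit theorem of the C∞ door on the analytic side: for POLYNOMIAL even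
profiles `f_j(x) = Σ_{q∈s} c_{jq} x^q` (even powers, real coefficients) it produces the coupling majorant `hUqe` of
`weilPositivityOn_of_formatC_cinfB/BA` from

* the COLLECTED far rows `|M⁺(n,m) − (−1)^m Σ_x P_row(n,x)φ_x(m)| ≤ ρ_row(n)·w(m)` (`n ≤ B`, `m ≥ m₀`;
  `abs_evenRow_sub_collected_le` + `twoGroups_eq_sum_fin`),
* the COLLECTED monomial images `|Re W(1x^q, χ_m) − (−1)^m Σ_x P_img(q,x)φ_x(m)| ≤ ρ_img(q)·w(m)` (`q ∈ s`;
  `abs_re_image_pow_sub_collected_le` + `fourGroups_eq_sum_fin`),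
* the COLLECTED profile table `V_j(m) = (−1)^m Σ_x R(j,x)φ_x(m)` (exact; `PolyWindowFourierFamilies`),
* the data: free-map matrices `Λ₁, Λ₂`, far diagonal `d̂` with floor `d₀` on `[m₀,∞)`, the exact middle-range majorant
  `Ufin` on `[B+1, m₀)`, the weight energy `Σ_{m≥m₀} w(m)² ≤ W`, and an `N`-uniform family Gram majorant `Γ`,

over ANY finite family index `ι` (`coupling_majorant_gram_shifted_fintype`).  The image entries are assembled by
`WeilFormatCCinfImageGlue` (`Re W(1f_j − proj_B 1f_j, w⁺_m)/d_m = Σ_q c_{jq} Re W(1x^q, χ_m) − Σ_{n≤B} M⁺(n,m)V_j(n)`) and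
`abs_sum_mul_sub_collected_le`, so the image coefficient matrix is `Q(j,x) = Σ_q c_{jq}P_img(q,x) − Σ_{n≤B} V_j(n)P_row(n,x)`
with remainder `ρβ_j = Σ_q |c_{jq}|ρ_img(q) + Σ_{n≤B} |V_j(n)|ρ_row(n)`.  Pure assembly; standard axioms; no definitions;
no RH claim.
-/

set_option autoImplicit false
-- `Summit.RiemannHypothesis.RiemannHypothesis.…` is the layout-mandated namespace (summit = problem name).
set_option linter.dupNamespace false

noncomputable section

open Complex Filter Set MeasureTheory Finset
open scoped Real Topology ComplexConjugate

namespace Summit.RiemannHypothesis.RiemannHypothesis.Theorems.WeilFormatC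

open Literature.NumberTheory.LFunctions Literature.NumberTheory.LFunctions.Yoshida1992

variable {a : ℝ}

/-! ## Small algebra -/

/-- Difference of two collected objects. -/
theorem abs_sub_sub_collected_le {ι : Type*} [Fintype ι] {X Y ε w ρX ρY : ℝ} {A B φ : ι → ℝ}
    (hX : |X - ε * ∑ f, A f * φ f| ≤ ρX * w) (hY : |Y - ε * ∑ f, B f * φ f| ≤ ρY * w) :
    |(X - Y) - ε * ∑ f, (A f - B f) * φ f| ≤ (ρX + ρY) * w := by
  have e : (X - Y) - ε * ∑ f, (A f - B f) * φ f = (X - ε * ∑ f, A f * φ f) - (Y - ε * ∑ f, B f * φ f) := by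
    simp only [sub_mul, Finset.sum_sub_distrib]; ring
  rw [e, add_mul]
  exact (abs_sub _ _).trans (add_le_add hX hY)

/-- An even real polynomial window: `x ↦ Σ_{q∈s} c_q x^q` with even powers is even and real. -/
theorem poly_even_real (s : Finset ℕ) (c : ℕ → ℝ) (hs : ∀ q ∈ s, Even q) :
    (∀ x : ℝ, (fun x : ℝ ↦ ∑ q ∈ s, ((c q : ℝ) : ℂ) * ((x : ℂ)) ^ q) (-x)
        = (fun x : ℝ ↦ ∑ q ∈ s, ((c q : ℝ) : ℂ) * ((x : ℂ)) ^ q) x) ∧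
      (∀ x : ℝ, conj ((fun x : ℝ ↦ ∑ q ∈ s, ((c q : ℝ) : ℂ) * ((x : ℂ)) ^ q) x)
        = (fun x : ℝ ↦ ∑ q ∈ s, ((c q : ℝ) : ℂ) * ((x : ℂ)) ^ q) x) := by
  refine ⟨fun x ↦ Finset.sum_congr rfl fun q hq ↦ ?_, fun x ↦ ?_⟩
  · rw [Complex.ofReal_neg, (hs q hq).neg_pow]
  · rw [map_sum]
    refine Finset.sum_congr rfl fun q _ ↦ ?_
    rw [map_mul, map_pow, Complex.conj_ofReal, Complex.conj_ofReal]

/-! ## The even coupling majorant from collected data -/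

/-- **The even `hUq` of the DoorB certificates from collected monomial data.**  See the module docstring; the
conclusion is literally the `hUqe` hypothesis of `weilPositivityOn_of_formatC_cinfB(A)` for the polynomial profiles
`fe j = Σ_{q∈s} c_{jq} x^q`, the matrix free map `Λe x β j = Σ_i Λ₁(j,i)x_i + Σ_{j'} Λ₂(j,j')β_{j'}` and
`Uqe x β = Ufin x β + ((1+θ)Γ(u(x,β)) + (1+θ⁻¹)W(Σρ)(Σρ z²))/d₀`. -/
theorem cinf_hUq_even (ha : 0 < a) {Be re m₀ : ℕ} (hBm : Be < m₀) (s : Finset ℕ) (hs : ∀ q ∈ s, Even q)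
    (coef : Fin re → ℕ → ℝ)
    {ι : Type*} [Fintype ι] (φ : ι → ℕ → ℝ) (w : ℕ → ℝ)
    -- collected rows `n ≤ Be`
    (Prow : ℕ → ι → ℝ) (ρrow : ℕ → ℝ) (hρrow : ∀ n, 0 ≤ ρrow n)
    (hrow : ∀ m, m₀ ≤ m → ∀ n, n ≤ Be →
      |(if n = 0 then gramCoeff a 0 m else if m = 0 then gramCoeff a n 0
          else (gramCoeff a n m + gramCoeff a n (-(m : ℤ))) / 2)
        - (-1 : ℝ) ^ m * ∑ f, Prow n f * φ f m| ≤ ρrow n * w m)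
    -- collected monomial images `q ∈ s`
    (Pimg : ℕ → ι → ℝ) (ρimg : ℕ → ℝ) (hρimg : ∀ q, 0 ≤ ρimg q)
    (himg : ∀ m, m₀ ≤ m → ∀ q ∈ s,
      |(weilWindowSesq a ((Icc (-a) a).indicator fun x : ℝ ↦ ((x : ℂ)) ^ q) (chi a m)).re
        - (-1 : ℝ) ^ m * ∑ f, Pimg q f * φ f m| ≤ ρimg q * w m)
    -- collected profile table (exact)
    (Rtab : Fin re → ι → ℝ)
    (hV : ∀ m, m₀ ≤ m → ∀ j : Fin re,
      (if m = 0 then 1 else 2) * (Yoshida1992.fourierCoeff a m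
          ((Icc (-a) a).indicator fun x : ℝ ↦ ∑ q ∈ s, ((coef j q : ℝ) : ℂ) * ((x : ℂ)) ^ q)).re / Real.sqrt (2 * a)
        = (-1 : ℝ) ^ m * ∑ f, Rtab j f * φ f m)
    -- data: free map, far diagonal, middle range, weights, family Gram
    (Λ₁ : Fin re → Fin (Be + 1) → ℝ) (Λ₂ : Fin re → Fin re → ℝ)
    (dhat : ℕ → ℝ) (hd : ∀ m, Be + 1 ≤ m → 0 < dhat m) {d₀ : ℝ} (hd₀ : 0 < d₀) (hd₃ : ∀ m, m₀ ≤ m → d₀ ≤ dhat m)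
    (Ufin : (Fin (Be + 1) → ℝ) → (Fin re → ℝ) → ℝ)
    (hfin : ∀ (x : Fin (Be + 1) → ℝ) (β : Fin re → ℝ),
      ∑ m ∈ Ico (Be + 1) m₀,
        (∑ i : Fin (Be + 1), (if (i : ℕ) = 0 then gramCoeff a 0 m else if m = 0 then gramCoeff a i 0
            else (gramCoeff a i m + gramCoeff a i (-(m : ℤ))) / 2) * x i
          + ∑ j, ((weilWindowSesq a ((Icc (-a) a).indicator (fun x : ℝ ↦ ∑ q ∈ s, ((coef j q : ℝ) : ℂ) * ((x : ℂ)) ^ q)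
              - proj a Be ((Icc (-a) a).indicator fun x : ℝ ↦ ∑ q ∈ s, ((coef j q : ℝ) : ℂ) * ((x : ℂ)) ^ q))
              (chiEven a m)).re / (if m = 0 then 1 else Real.sqrt 2)) * β j
          - ∑ j, ((if m = 0 then 1 else 2) * (Yoshida1992.fourierCoeff a m
              ((Icc (-a) a).indicator fun x : ℝ ↦ ∑ q ∈ s, ((coef j q : ℝ) : ℂ) * ((x : ℂ)) ^ q)).re / Real.sqrt (2 * a))
              * (∑ i, Λ₁ j i * x i + ∑ j', Λ₂ j j' * β j')) ^ 2 / dhat m ≤ Ufin x β)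
    {W : ℝ} (hW : ∀ N, ∑ m ∈ Ico m₀ N, w m ^ 2 ≤ W)
    (Γ : (ι → ℝ) → ℝ) (hΓ : ∀ (N : ℕ) (u : ι → ℝ), ∑ m ∈ Ico m₀ N, (∑ f, u f * φ f m) ^ 2 ≤ Γ u)
    {θ : ℝ} (hθ : 0 < θ) (N : ℕ) (x : Fin (Be + 1) → ℝ) (β : Fin re → ℝ) :
    ∑ m ∈ Ico (Be + 1) N,
        (∑ i : Fin (Be + 1), (if (i : ℕ) = 0 then gramCoeff a 0 m else if m = 0 then gramCoeff a i 0
            else (gramCoeff a i m + gramCoeff a i (-(m : ℤ))) / 2) * x i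
          + ∑ j, ((weilWindowSesq a ((Icc (-a) a).indicator (fun x : ℝ ↦ ∑ q ∈ s, ((coef j q : ℝ) : ℂ) * ((x : ℂ)) ^ q)
              - proj a Be ((Icc (-a) a).indicator fun x : ℝ ↦ ∑ q ∈ s, ((coef j q : ℝ) : ℂ) * ((x : ℂ)) ^ q))
              (chiEven a m)).re / (if m = 0 then 1 else Real.sqrt 2)) * β j
          - ∑ j, ((if m = 0 then 1 else 2) * (Yoshida1992.fourierCoeff a m
              ((Icc (-a) a).indicator fun x : ℝ ↦ ∑ q ∈ s, ((coef j q : ℝ) : ℂ) * ((x : ℂ)) ^ q)).re / Real.sqrt (2 * a))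
              * (∑ i, Λ₁ j i * x i + ∑ j', Λ₂ j j' * β j')) ^ 2 / dhat m
      ≤ Ufin x β + ((1 + θ) * Γ (fun f ↦ ∑ i : Fin (Be + 1), (Prow i f - ∑ j, Rtab j f * Λ₁ j i) * x i
            + ∑ j', ((∑ q ∈ s, coef j' q * Pimg q f
                      - ∑ n ∈ Finset.range (Be + 1),
                          ((if n = 0 then 1 else 2) * (Yoshida1992.fourierCoeff a n
                            ((Icc (-a) a).indicator fun x : ℝ ↦ ∑ q ∈ s, ((coef j' q : ℝ) : ℂ) * ((x : ℂ)) ^ q)).re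
                            / Real.sqrt (2 * a)) * Prow n f)
                    - ∑ j, Rtab j f * Λ₂ j j') * β j')
          + (1 + 1 / θ) * (W * ((∑ i : Fin (Be + 1), ρrow i
                + ∑ j, (∑ q ∈ s, |coef j q| * ρimg q
                    + ∑ n ∈ Finset.range (Be + 1), |(if n = 0 then 1 else 2) * (Yoshida1992.fourierCoeff a n
                        ((Icc (-a) a).indicator fun x : ℝ ↦ ∑ q ∈ s, ((coef j q : ℝ) : ℂ) * ((x : ℂ)) ^ q)).re
                        / Real.sqrt (2 * a)| * ρrow n))
              * (∑ i : Fin (Be + 1), ρrow i * x i ^ 2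
                + ∑ j, (∑ q ∈ s, |coef j q| * ρimg q
                    + ∑ n ∈ Finset.range (Be + 1), |(if n = 0 then 1 else 2) * (Yoshida1992.fourierCoeff a n
                        ((Icc (-a) a).indicator fun x : ℝ ↦ ∑ q ∈ s, ((coef j q : ℝ) : ℂ) * ((x : ℂ)) ^ q)).re
                        / Real.sqrt (2 * a)| * ρrow n) * β j ^ 2)))) / d₀ := by
  -- the images: projection removed, polynomial expanded, collected by linear combination
  have hc : ∀ m, m₀ ≤ m → ∀ j : Fin re,
      |(weilWindowSesq a ((Icc (-a) a).indicator (fun x : ℝ ↦ ∑ q ∈ s, ((coef j q : ℝ) : ℂ) * ((x : ℂ)) ^ q)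
              - proj a Be ((Icc (-a) a).indicator fun x : ℝ ↦ ∑ q ∈ s, ((coef j q : ℝ) : ℂ) * ((x : ℂ)) ^ q))
              (chiEven a m)).re / (if m = 0 then 1 else Real.sqrt 2)
        - (-1 : ℝ) ^ m * ∑ f, (∑ q ∈ s, coef j q * Pimg q f
              - ∑ n ∈ Finset.range (Be + 1),
                  ((if n = 0 then 1 else 2) * (Yoshida1992.fourierCoeff a n
                    ((Icc (-a) a).indicator fun x : ℝ ↦ ∑ q ∈ s, ((coef j q : ℝ) : ℂ) * ((x : ℂ)) ^ q)).re
                    / Real.sqrt (2 * a)) * Prow n f) * φ f m|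
        ≤ (∑ q ∈ s, |coef j q| * ρimg q
            + ∑ n ∈ Finset.range (Be + 1), |(if n = 0 then 1 else 2) * (Yoshida1992.fourierCoeff a n
                ((Icc (-a) a).indicator fun x : ℝ ↦ ∑ q ∈ s, ((coef j q : ℝ) : ℂ) * ((x : ℂ)) ^ q)).re
                / Real.sqrt (2 * a)| * ρrow n) * w m := by
    intro m hm j
    have hm0 : m ≠ 0 := by omega
    obtain ⟨hev, hre⟩ := poly_even_real s (coef j) hs
    have hevI := indicator_even (f := fun x : ℝ ↦ ∑ q ∈ s, ((coef j q : ℝ) : ℂ) * ((x : ℂ)) ^ q) hev a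
    have hreI := indicator_real (f := fun x : ℝ ↦ ∑ q ∈ s, ((coef j q : ℝ) : ℂ) * ((x : ℂ)) ^ q) hre a
    rw [re_weilWindowSesq_sub_proj_chiEven_div ha hevI hreI (isWindowFunction_indicator_poly a s _) (by omega),
      if_neg hm0, re_weilWindowSesq_indicator_poly_chiEven_div ha s (coef j) hm0]
    have h1 : |∑ q ∈ s, coef j q * ((1 + (-1 : ℝ) ^ q) / 2) *
          (weilWindowSesq a ((Icc (-a) a).indicator fun x : ℝ ↦ ((x : ℂ)) ^ q) (chi a m)).re
        - (-1 : ℝ) ^ m * ∑ f, (∑ q ∈ s, coef j q * Pimg q f) * φ f m| ≤ (∑ q ∈ s, |coef j q| * ρimg q) * w m := by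
      have h := abs_sum_mul_sub_collected_le s (coef j)
        (fun q ↦ (weilWindowSesq a ((Icc (-a) a).indicator fun x : ℝ ↦ ((x : ℂ)) ^ q) (chi a m)).re)
        Pimg (fun f ↦ φ f m) ((-1 : ℝ) ^ m) (w m) ρimg (himg m hm)
      have e : ∑ q ∈ s, coef j q * ((1 + (-1 : ℝ) ^ q) / 2) *
            (weilWindowSesq a ((Icc (-a) a).indicator fun x : ℝ ↦ ((x : ℂ)) ^ q) (chi a m)).re
          = ∑ q ∈ s, coef j q *
            (weilWindowSesq a ((Icc (-a) a).indicator fun x : ℝ ↦ ((x : ℂ)) ^ q) (chi a m)).re :=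
        Finset.sum_congr rfl fun q hq ↦ by rw [(hs q hq).neg_one_pow]; ring
      rw [e]; exact h
    have h2 : |∑ n ∈ Finset.range (Be + 1),
          (if n = 0 then gramCoeff a 0 m else if m = 0 then gramCoeff a n 0
            else (gramCoeff a n m + gramCoeff a n (-(m : ℤ))) / 2) *
          ((if n = 0 then 1 else 2) * (Yoshida1992.fourierCoeff a n
            ((Icc (-a) a).indicator fun x : ℝ ↦ ∑ q ∈ s, ((coef j q : ℝ) : ℂ) * ((x : ℂ)) ^ q)).re / Real.sqrt (2 * a))
        - (-1 : ℝ) ^ m * ∑ f, (∑ n ∈ Finset.range (Be + 1),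
            ((if n = 0 then 1 else 2) * (Yoshida1992.fourierCoeff a n
              ((Icc (-a) a).indicator fun x : ℝ ↦ ∑ q ∈ s, ((coef j q : ℝ) : ℂ) * ((x : ℂ)) ^ q)).re
              / Real.sqrt (2 * a)) * Prow n f) * φ f m|
        ≤ (∑ n ∈ Finset.range (Be + 1), |(if n = 0 then 1 else 2) * (Yoshida1992.fourierCoeff a n
            ((Icc (-a) a).indicator fun x : ℝ ↦ ∑ q ∈ s, ((coef j q : ℝ) : ℂ) * ((x : ℂ)) ^ q)).re
            / Real.sqrt (2 * a)| * ρrow n) * w m := by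
      have h := abs_sum_mul_sub_collected_le (Finset.range (Be + 1))
        (fun n ↦ (if n = 0 then 1 else 2) * (Yoshida1992.fourierCoeff a n
            ((Icc (-a) a).indicator fun x : ℝ ↦ ∑ q ∈ s, ((coef j q : ℝ) : ℂ) * ((x : ℂ)) ^ q)).re / Real.sqrt (2 * a))
        (fun n ↦ (if n = 0 then gramCoeff a 0 m else if m = 0 then gramCoeff a n 0
            else (gramCoeff a n m + gramCoeff a n (-(m : ℤ))) / 2))
        Prow (fun f ↦ φ f m) ((-1 : ℝ) ^ m) (w m) ρrow
        (fun n hn ↦ hrow m hm n (by have := Finset.mem_range.1 hn; omega))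
      have e : ∑ n ∈ Finset.range (Be + 1),
            (if n = 0 then gramCoeff a 0 m else if m = 0 then gramCoeff a n 0
              else (gramCoeff a n m + gramCoeff a n (-(m : ℤ))) / 2) *
            ((if n = 0 then 1 else 2) * (Yoshida1992.fourierCoeff a n
              ((Icc (-a) a).indicator fun x : ℝ ↦ ∑ q ∈ s, ((coef j q : ℝ) : ℂ) * ((x : ℂ)) ^ q)).re / Real.sqrt (2 * a))
          = ∑ n ∈ Finset.range (Be + 1),
            ((if n = 0 then 1 else 2) * (Yoshida1992.fourierCoeff a n
              ((Icc (-a) a).indicator fun x : ℝ ↦ ∑ q ∈ s, ((coef j q : ℝ) : ℂ) * ((x : ℂ)) ^ q)).re / Real.sqrt (2 * a))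
            * (if n = 0 then gramCoeff a 0 m else if m = 0 then gramCoeff a n 0
              else (gramCoeff a n m + gramCoeff a n (-(m : ℤ))) / 2) :=
        Finset.sum_congr rfl fun n _ ↦ mul_comm _ _
      rw [e]; exact h
    exact abs_sub_sub_collected_le h1 h2
  -- the structured tail over `ι`
  have key := coupling_majorant_gram_shifted_fintype (ι := ι)
    (fun (i m : ℕ) ↦ (if i = 0 then gramCoeff a 0 m else if m = 0 then gramCoeff a i 0
        else (gramCoeff a i m + gramCoeff a i (-(m : ℤ))) / 2))
    (B := Be + 1) (B₃ := m₀) (r := re) (by omega)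
    (fun m j ↦ (weilWindowSesq a ((Icc (-a) a).indicator (fun x : ℝ ↦ ∑ q ∈ s, ((coef j q : ℝ) : ℂ) * ((x : ℂ)) ^ q)
              - proj a Be ((Icc (-a) a).indicator fun x : ℝ ↦ ∑ q ∈ s, ((coef j q : ℝ) : ℂ) * ((x : ℂ)) ^ q))
              (chiEven a m)).re / (if m = 0 then 1 else Real.sqrt 2))
    (fun m j ↦ (if m = 0 then 1 else 2) * (Yoshida1992.fourierCoeff a m
        ((Icc (-a) a).indicator fun x : ℝ ↦ ∑ q ∈ s, ((coef j q : ℝ) : ℂ) * ((x : ℂ)) ^ q)).re / Real.sqrt (2 * a))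
    Λ₁ Λ₂ dhat hd hd₀ hd₃ Ufin hfin (fun m ↦ (-1 : ℝ) ^ m) (fun m ↦ by rw [← pow_mul, mul_comm, pow_mul]; norm_num)
    φ (fun f (i : Fin (Be + 1)) ↦ Prow i f)
    (fun f j ↦ ∑ q ∈ s, coef j q * Pimg q f
        - ∑ n ∈ Finset.range (Be + 1),
            ((if n = 0 then 1 else 2) * (Yoshida1992.fourierCoeff a n
              ((Icc (-a) a).indicator fun x : ℝ ↦ ∑ q ∈ s, ((coef j q : ℝ) : ℂ) * ((x : ℂ)) ^ q)).re
              / Real.sqrt (2 * a)) * Prow n f)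
    (fun f j ↦ Rtab j f) w (fun i ↦ ρrow i)
    (fun j ↦ ∑ q ∈ s, |coef j q| * ρimg q
        + ∑ n ∈ Finset.range (Be + 1), |(if n = 0 then 1 else 2) * (Yoshida1992.fourierCoeff a n
            ((Icc (-a) a).indicator fun x : ℝ ↦ ∑ q ∈ s, ((coef j q : ℝ) : ℂ) * ((x : ℂ)) ^ q)).re
            / Real.sqrt (2 * a)| * ρrow n)
    (fun i ↦ hρrow i)
    (fun j ↦ add_nonneg (Finset.sum_nonneg fun q _ ↦ mul_nonneg (abs_nonneg _) (hρimg q))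
      (Finset.sum_nonneg fun n _ ↦ mul_nonneg (abs_nonneg _) (hρrow n)))
    (fun m hm i ↦ hrow m hm i (by have := i.2; omega))
    hc (fun m hm j ↦ hV m hm j) hW Γ hΓ hθ N x β
  exact key

end Summit.RiemannHypothesis.RiemannHypothesis.Theorems.WeilFormatC
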